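import Summits.BirchSwinnertonDyer.Rank1Residual.Supersingular.SignedRankZero
import Literature.NumberTheory.EllipticCurves.Rank1Residual.Typed.X7
import HarnessLib

/-!
# Class X7 (good supersingular `p`, `E` NOT semistable), analytic rank `0`, odd `p`, surjective
# image: `BSD(E,p)` from ONE signed (`±` or `♯/♭`) divisibility — the X7 reading of the signed
# rank-zero chain (cell `b2b-bsdres`, supersingular family, joint step of provers A = `x10b` and
# B = `additive-p3`; written by B)

HONEST FRAMING (run/shared/lean/b2b/bsd-rank1-residual/, verbatim in every file): the goal of the
cell is to DELETE the COMBINATION-SHAPED residual classes of the Birch–Swinnerton-Dyer formula for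
ALL analytic-rank `≤ 1` elliptic curves over `ℚ` — "full BSD formula for every rank `≤ 1` curve in
class `C`" assembled STRICTLY from published theorems — so that the rank-`≤ 1` remainder becomes
exactly the CONSTRUCTION-SHAPED classes, which are TYPED (missing-input `Prop`s), NOT attempted.
This is not "finishing BSD". Theorems only; NO named fact, NO definition; no label change (X7 stays
CONSTRUCTION-SHAPED); nothing about any curve is asserted; nothing is booked.

Class X7 (`ClassX7 W p := GoodSS W p ∧ ¬ Semistable W`; census hyp SHARPENED §7: 332 ‖ 79 pairs,
rank-`0` core 28 ‖ 8 pairs with `p² ∣ #Ш_an`, plus 9 ‖ 3 non-surjective-image rank-`0` pairs) has, in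
analytic rank `0` at an odd `p` with `ρ̄_{E,p}` surjective, its UPPER half in print (Wuthrich 2014
Prop. 21; `Typed.X7.bsdp_of_missingLowerBoundAt_of_surj`), so the typed missing input there IS the
lower bound `MissingLowerBoundAt W p`. Prover A's `Supersingular/SignedRankZero.lean` (p206397)
turns ONE divisibility of a signed main conjecture into exactly that lower bound, for ANY signed
datum `(ξ, L, c)` with (K) Euler characteristic, (P) interpolation, `p ∤ c`, (MC↓) `L ∣ ξ`
(`missingLowerBoundAt_of_signedLowerDivisibility`); nothing in the chain uses semistability (it is a
statement about `Λ`-divisibility and constant terms). Hence the X7 reading below. WHICH signed theory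
the datum comes from depends on `a_p`: Kobayashi–Pollack `±` when `a_p = 0` (every X7 pair with
`p ≥ 5`, and `p = 3` with `a_3 = 0`; (K) = B. D. Kim 2013, (P) = Pollack 2003 — A's reading), Sprung's
`♯/♭` when `p = 3`, `a_3 = ±3` (then the pair is also X8; (K•) = Sprung arXiv:1610.10017 §4, PRE;
(P•) = Sprung ANT 2017 table — B's reading, file `SharpFlatRankZero.lean`). The OPEN input is (MC↓):
BSTW Thm. 1.3/1.5 (PRE) need `E` semistable or a quadratic twist of a semistable curve (iw-2's
`x7_twist_clause.tsv`: 11 of 332 X7 pairs meet the twist clause), so on X7 proper NOTHING is even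
announced class-wide; per pair Kim–Kim–Sun 2020 Thm. 1.1 (unit Kurihara number ⇒ Kato IMC;
`p ≥ 5` clean, `p = 3` flag `KKS20@3-MR-H4`) with Kobayashi Thm. 7.4 / Sprung 2012 Prop. 7.19
(Kato MC ⟺ signed MC) is the certificate route. The 9 ‖ 3 non-surjective rank-`0` pairs are NOT
addressed (no published upper bound; `X7.missingInputAt_iff_missingPPartAt_of_not_surj`).

References: Kobayashi, Invent. Math. 152 (2003) Thms. 1.2, 4.1, 7.4 [Kobayashi2003]; Sprung,
J. Number Theory 132 (2012) Thms. 1.2, 1.4, Prop. 7.19 [Sprung2012]; Kim–Kim–Sun, Selecta Math. 26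
(2020) Thm. 1.1 [KimKimSun2020]; Ray–Sprung, Ann. Inst. Fourier 75 (2025) §1.2 [RaySprung2025];
Wuthrich, Doc. Math. 19 (2014) Prop. 21 [Wuthrich2014]; Miller 2011 Def. 1.1 [Miller2011LMS];
cell files HOME/b2b-bsdres-x10b/X6-ROUTE.md, HOME/b2b-bsdres-additive-p3/X8-ROUTE-B.md.
-/

set_option autoImplicit false

noncomputable section

open scoped Classical

open WeierstrassCurve Literature.NumberTheory.EllipticCurves
  Literature.NumberTheory.EllipticCurves.Rank1Residual
  Literature.NumberTheory.EllipticCurves.Rank1Residual.Typed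

namespace Summit.BirchSwinnertonDyer.Rank1Residual.Supersingular

variable (W : WeierstrassCurve ℚ) [W.IsElliptic] [W.IsGloballyMinimal] (p : ℕ) [Fact p.Prime]

/-- **X7 ∧ `r_an = 0` ∧ odd `p` ∧ surj(p): `BSD(E,p)` from ONE signed divisibility.** On class X7
(good supersingular `p`, `E` not semistable) in analytic rank `0` at an odd prime with `ρ̄_{E,p}`
surjective, granted Wuthrich 2014 Prop. 21 (`hW`, PUB), GZK (`hGZK`) and modularity (`hmod`): a
signed datum (`±` if `a_p = 0`, `♯/♭` if `p = 3`, `a_3 = ±3`) satisfying (K), (P) with `p ∤ c`, and the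
Eisenstein divisibility (MC↓) `L ∣ ξ` gives Miller's `BSDp W p`; irreducibility of `E[p]` is
automatic (`ClassX7.irr`, Serre 1972 Prop. 12). The OPEN input is (MC↓) (nothing announced for
non-semistable `E`; per pair KKS 2020 Thm. 1.1 + Kobayashi Thm. 7.4 / Sprung Prop. 7.19). Per pair;
NOT a class theorem. [cite: Kobayashi2003, Thms. 1.2, 4.1, 7.4] [cite: Sprung2012, Thm. 1.2, Prop. 7.19]
[cite: Wuthrich2014, Prop. 21 (p. 400)] [cite: Miller2011LMS, Def. 1.1] -/
theorem X7.bsdp_of_signedLowerDivisibility_of_surj_of_analyticRank_eq_zero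
    (hW : Wuthrich2014.sha_dvd_analyticSha)
    (hGZK : rank_eq_analyticRank_of_analyticRank_le_one) (hmod : hasEntireLFunction_rat)
    (hp : p ≠ 2) (hX : ClassX7 W p) (hs : Surj W p) (h0 : W.analyticRank = 0)
    (D : SignedDatum W p) (hc : ¬ p ∣ D.c) (hK : D.EulerCharacteristic) (hP : D.Interpolation)
    (hdiv : D.LowerDivisibility) : BSDp W p := by
  have hL : W.entireLFunction 1 ≠ 0 := (W.analyticRank_eq_zero_iff_holds (hmod W)).1 h0
  exact X7.bsdp_of_missingLowerBoundAt_of_surj W p hW hGZK hmod hp hX hs h0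
    (missingLowerBoundAt_of_signedLowerDivisibility W p hGZK (ClassX7.irr W p hp hX) hL D hc hK hP
      hdiv)

/-- **Bookkeeping: the signed divisibility delivers the typed missing input of X7** in analytic rank
`0` at an odd `p` with surjective image (`X7.MissingInputAt`, `Typed/X7.lean`).
[cite: Kobayashi2003, Thm. 1.2] [cite: Sprung2012, Prop. 7.19] [cite: Miller2011LMS, Def. 1.1] -/
theorem X7.missingInputAt_of_signedLowerDivisibility_of_surj
    (hGZK : rank_eq_analyticRank_of_analyticRank_le_one) (hmod : hasEntireLFunction_rat)
    (hp : p ≠ 2) (hX : ClassX7 W p) (hs : Surj W p) (h0 : W.analyticRank = 0)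
    (D : SignedDatum W p) (hc : ¬ p ∣ D.c) (hK : D.EulerCharacteristic) (hP : D.Interpolation)
    (hdiv : D.LowerDivisibility) : X7.MissingInputAt W p := by
  have hL : W.entireLFunction 1 ≠ 0 := (W.analyticRank_eq_zero_iff_holds (hmod W)).1 h0
  have hlow : MissingLowerBoundAt W p :=
    missingLowerBoundAt_of_signedLowerDivisibility W p hGZK (ClassX7.irr W p hp hX) hL D hc hK hP hdiv
  exact (X7.missingInputAt_iff_of_analyticRank_eq_zero W p hp hX h0).mpr
    ⟨fun _ => hlow, fun hns => absurd hs hns⟩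

end Summit.BirchSwinnertonDyer.Rank1Residual.Supersingular

end
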